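/-
Copyright (c) 2026 the pub-hodgecm-mathlib formalisation cell (harness21).  Prover seat hodgecm-mathlib-K2Liu-p07 (g3), Track B «K2-LIT»,
#184♮ = hLiu418 = `stmt-HodgeConjecture-24832`; #42S payer road, organ S1 (local Siegel–Weil spanning), ROAD W («M-157t»), file F5c-A
(split with K2Liu-p01 (g7) 2026-09-04T10:19:43Z; census K2Liu-p07 (g3) 10:5xZ on `K2/STATUS.md`).
-/
import Summits.HodgeConjecture.HodgeConjecture.Theorems.K2LiuLocalSWSectionDefs      -- ★ D-A v1: `tensorEmbLoc`, `coe_tensorEmbLoc_apply` (+ ★ `epsD`, `epsV`, `tensorFrame`)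
import Literature.NumberTheory.GelbartRogawski1991.LocalDoubledUnitaryBigCellValue     -- ★ `transverseHerm`, `det_transverseHerm`, `matA`, `gramS`, adapted blocks
import Literature.NumberTheory.GelbartRogawski1991.LocalDoubledUnitaryIwahori          -- ★ `isSiegelDelta_iff_blkC_eq_zero`
import Literature.NumberTheory.GelbartRogawski1991.LocalDoubledUnitaryKudlaSplitting   -- ★ `matS_map_eval`
import Literature.NumberTheory.GelbartRogawski1991.DoubledWeilRepresentationLocalFamilyCM -- ★ `GRConstruction.gramR_isSymm`, `hermD_eq_map_gramD`
import HarnessLib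

/-!
# Crux `HLiu418`, #42S organ S1, ROAD W, file F5c-A: THE `Δ`-ADAPTED BLOCKS OF `h ⊗ 1_{V′}` ARE THE KRONECKER PRODUCTS OF THOSE OF `h`
# (bookkeeping of the local tensor embedding `U(𝔻)(L⁺_v) → U(𝔻 ⊗ V′)(L⁺_v)` in Kudla's adapted frame; the transverse hermitian matrix
# `H′(a ⊗ 1, b ⊗ 1) = H(a, b) ⊗ diag dV′` and its determinant)

Cell `hodgecm-mathlib`, crux item hLiu418 = `stmt-HodgeConjecture-24832`; squad K2 ∕ K2Liu; dealer K2E5-plan (g7), organ lead K2Liu-p06 (g4); prover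
K2Liu-p07 (g3).  THEOREMS ONLY (no `def`, no instance, no notation, no named-fact hypothesis, no `sorry`); lane
`--supports stmt-HodgeConjecture-24832 --as helper`.

WHY.  ROAD W of organ S1 (`I_v(½, χ_v) = R₂(V⁺_v) + R₂(V⁻_v)`, census `K2/K2Liu-p06/g4/CENSUS-S1-LocalSWSpanning.K2Liu-p06-g4.md` §0 (W3), LEAD ruling «M-157t»)
needs the two RELATIVE Weil-index facts `β⁺(w₁)∕β⁻(w₁) = −1`, `β⁺(w₂)∕β⁻(w₂) = +1` for Kudla's splittings `β^± = β_{𝔻 ⊗ V′^±} ∘ (· ⊗ 1)` (file F5c-B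
`K2LiuLocalSWRelativeWeilIndex`).  Kudla's `β` and the Leray cocycle of `ℓ_Δ` are computed in the tree through the `Δ`-ADAPTED BLOCKS `A, B, C, D` of
`matA g` (★ `DoubledUnitaryAdaptedBlocks`, `LocalDoubledUnitaryLagrangians`): the big cell is `{C invertible}` (★ `iotaD_mem_bigCell_iff_isUnit_blkC`), `P_Δ = {C = 0}`
(★ `isSiegelDelta_iff_blkC_eq_zero`), and on the big cell `c(ι a, ι b) = γ_{ψ′}(Res H(a, b))` with `H(a, b) = (2d⁻¹δ)·P(a, ab)` (★ `localLeray_val_eq_weilIndex_resQF`).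
This file transports that calculus along ★ `tensorEmbLoc v : h ↦ reindex epsD (h_w ⊗ₖ 1_{V′})`:
* §1 (ANY commutative ring, pure matrix algebra): for `eΣ e := sumProdDistrib ≫ (e ⊕ e)` built from `e : ι × κ ≃ ι′`,
  `reindex (eΣ e) (eΣ e) (fromBlocks A B C D ⊗ₖ X) = fromBlocks (reindex e e (A ⊗ₖ X)) …` (`reindex_fromBlocks_kronecker`), hence the four adapted blocks of
  `reindex eΣ (M ⊗ₖ X)` are `reindex e (blk M ⊗ₖ X)` (`blk_reindex_kronecker`) and Kudla's transverse matrix is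
  `transverseMatrix (reindex e (T ⊗ₖ D)) σ (reindex eΣ (M ⊗ₖ 1)) (reindex eΣ (P ⊗ₖ 1)) = reindex e (transverseMatrix T σ M P ⊗ₖ D)` (`transverseMatrix_reindex_kronecker`).
* §2 (the K2Lit CM datum `(L, e, dV, dW)`, auxiliary diagonal frame `dV′ : Fin M₂ → L`, tensor frames `(eW, e′)`, finite place `v` of `L⁺`):
  `gramR_tensor` (`T₀′ = reindex epsV (T₀ ⊗ₖ diag dV′)`), `matS_tensorEmbLoc`, **`matA_tensorEmbLoc : matA n′ (h ⊗ 1) = reindex (eΣ epsV) (matA n h ⊗ₖ 1)`**,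
  `blkC_matA_tensorEmbLoc` (and `blkA`), `isUnit_blkC_tensorEmbLoc_iff` (big cell ↦ big cell, and only so), **`isSiegelDelta_tensorEmbLoc`** (`P_Δ ↦ P_{Δ′}`, local
  twin of ★ `isSiegelDelta_tensorEmb`), **`transverseHerm_tensorEmbLoc : H′(a ⊗ 1, b ⊗ 1) = reindex epsV (H(a, b) ⊗ₖ (diag dV′)_v)`** and
  **`det_transverseHerm_tensorEmbLoc : det H′ = (det H)^{M₂} · ((∏_k dV′_k)^n)_v`**.
References: [Kudla1994] §2 (doubled space, Siegel parabolic), §3 (adapted blocks, the transverse form), Thm. 3.1; [HarrisKudlaSweet1996] §1 (1.11), (1.14)–(1.16);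
[MoeglinVignerasWaldspurger1987] Chap. 1 I.17 (`h ↦ h ⊗ 1`).
HONEST LABEL.  Count-neutral helper: `HC_CM` is proved only modulo the 7 printed citations (2 remaining named inputs: hLiu418 = `stmt-HodgeConjecture-24832`,
h413 = `stmt-HodgeConjecture-24833`) until rung 0 closes.
-/

set_option autoImplicit false
set_option linter.dupNamespace false -- the mandated namespace repeats `HodgeConjecture.HodgeConjecture`

noncomputable section

open scoped Matrix Kronecker
open NumberField IsDedekindDomain Matrix
open Literature.NumberTheory.Automorphic Literature.NumberTheory.Automorphic.UnitaryGroup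
open Literature.NumberTheory.GelbartRogawski1991 Literature.NumberTheory.GelbartRogawski1991.GRConstruction
open Literature.NumberTheory.GelbartRogawski1991.UnitaryDualPair
open Literature.NumberTheory.GelbartRogawski1991.UnitaryDualPair.LocalSplitting
open Literature.NumberTheory.GelbartRogawski1991.AdaptedBlocks
open Literature.NumberTheory.K2Lit.SiegelDoubled
open Summit.HodgeConjecture.HodgeConjecture.Cruxes.HLiu418.K2LiuLocalSWSectionDefs

namespace Summit.HodgeConjecture.HodgeConjecture.Cruxes.HLiu418.K2LiuLocalSWTensorAdaptedBlocks

/-! ## §1 Pure matrix algebra: adapted blocks of `reindex eΣ (M ⊗ₖ X)` -/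

section Algebra

variable {R : Type*} [CommRing R] {ι κ ι' : Type*} (e : ι × κ ≃ ι')

/-- **the doubled frame is again a Kronecker frame, blockwise**: `reindex (eΣ e) (eΣ e) (fromBlocks A B C D ⊗ₖ X) = fromBlocks (reindex e e (A ⊗ₖ X)) …`,
`eΣ e := sumProdDistrib ≫ (e ⊕ e)`. [cite: Kudla1994, §2 (doubled space, Siegel parabolic)] -/
theorem reindex_fromBlocks_kronecker (A B C D : Matrix ι ι R) (X : Matrix κ κ R) :
    Matrix.reindex ((Equiv.sumProdDistrib ι ι κ).trans (e.sumCongr e)) ((Equiv.sumProdDistrib ι ι κ).trans (e.sumCongr e))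
        (Matrix.fromBlocks A B C D ⊗ₖ X) =
      Matrix.fromBlocks (Matrix.reindex e e (A ⊗ₖ X)) (Matrix.reindex e e (B ⊗ₖ X)) (Matrix.reindex e e (C ⊗ₖ X))
        (Matrix.reindex e e (D ⊗ₖ X)) := by
  ext (i | i) (j | j) <;>
    simp [Matrix.reindex_apply, Matrix.submatrix_apply, Matrix.kroneckerMap_apply,
      Equiv.sumProdDistrib_symm_apply_left, Equiv.sumProdDistrib_symm_apply_right, Matrix.fromBlocks_apply₁₁,
      Matrix.fromBlocks_apply₁₂, Matrix.fromBlocks_apply₂₁, Matrix.fromBlocks_apply₂₂]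

/-- the `(1,1)` block of `reindex eΣ (M ⊗ₖ X)` is `reindex e (M₁₁ ⊗ₖ X)` (and the three others). [cite: Kudla1994, §2 (doubled space, Siegel parabolic)] -/
theorem toBlocks_reindex_kronecker (M : Matrix (ι ⊕ ι) (ι ⊕ ι) R) (X : Matrix κ κ R) :
    (Matrix.reindex ((Equiv.sumProdDistrib ι ι κ).trans (e.sumCongr e)) ((Equiv.sumProdDistrib ι ι κ).trans (e.sumCongr e)) (M ⊗ₖ X)).toBlocks₁₁ =
        Matrix.reindex e e (M.toBlocks₁₁ ⊗ₖ X) ∧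
      (Matrix.reindex ((Equiv.sumProdDistrib ι ι κ).trans (e.sumCongr e)) ((Equiv.sumProdDistrib ι ι κ).trans (e.sumCongr e)) (M ⊗ₖ X)).toBlocks₁₂ =
        Matrix.reindex e e (M.toBlocks₁₂ ⊗ₖ X) ∧
      (Matrix.reindex ((Equiv.sumProdDistrib ι ι κ).trans (e.sumCongr e)) ((Equiv.sumProdDistrib ι ι κ).trans (e.sumCongr e)) (M ⊗ₖ X)).toBlocks₂₁ =
        Matrix.reindex e e (M.toBlocks₂₁ ⊗ₖ X) ∧
      (Matrix.reindex ((Equiv.sumProdDistrib ι ι κ).trans (e.sumCongr e)) ((Equiv.sumProdDistrib ι ι κ).trans (e.sumCongr e)) (M ⊗ₖ X)).toBlocks₂₂ =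
        Matrix.reindex e e (M.toBlocks₂₂ ⊗ₖ X) := by
  conv_lhs => rw [← Matrix.fromBlocks_toBlocks M]
  rw [reindex_fromBlocks_kronecker, Matrix.toBlocks_fromBlocks₁₁]
  refine ⟨rfl, ?_, ?_, ?_⟩
  · conv_lhs => rw [← Matrix.fromBlocks_toBlocks M]
    rw [reindex_fromBlocks_kronecker, Matrix.toBlocks_fromBlocks₁₂]
  · conv_lhs => rw [← Matrix.fromBlocks_toBlocks M]
    rw [reindex_fromBlocks_kronecker, Matrix.toBlocks_fromBlocks₂₁]
  · conv_lhs => rw [← Matrix.fromBlocks_toBlocks M]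
    rw [reindex_fromBlocks_kronecker, Matrix.toBlocks_fromBlocks₂₂]

/-- `reindex e e ((A + B) ⊗ₖ X) = reindex e e (A ⊗ₖ X) + reindex e e (B ⊗ₖ X)` and the `−`, `•` analogues (plumbing).
[cite: Kudla1994, §2 (doubled space, Siegel parabolic)] -/
theorem reindex_kronecker_linear (A B : Matrix ι ι R) (X : Matrix κ κ R) (r : R) :
    Matrix.reindex e e ((A + B) ⊗ₖ X) = Matrix.reindex e e (A ⊗ₖ X) + Matrix.reindex e e (B ⊗ₖ X) ∧
      Matrix.reindex e e ((A - B) ⊗ₖ X) = Matrix.reindex e e (A ⊗ₖ X) - Matrix.reindex e e (B ⊗ₖ X) ∧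
      Matrix.reindex e e ((r • A) ⊗ₖ X) = r • Matrix.reindex e e (A ⊗ₖ X) := by
  refine ⟨?_, ?_, ?_⟩ <;> ext i j <;>
    simp [Matrix.reindex_apply, Matrix.submatrix_apply, Matrix.kroneckerMap_apply, add_mul, sub_mul, mul_assoc]

/-- **the adapted blocks of `reindex eΣ (M ⊗ₖ X)` are `reindex e (blk M ⊗ₖ X)`** (`blk ∈ {A, B, C, D}` = `½(M₁₁ ± M₁₂ ± M₂₁ ± M₂₂)`).
[cite: Kudla1994, §3] -/
theorem blk_reindex_kronecker [Invertible (2 : R)] (M : Matrix (ι ⊕ ι) (ι ⊕ ι) R) (X : Matrix κ κ R) :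
    blkA (Matrix.reindex ((Equiv.sumProdDistrib ι ι κ).trans (e.sumCongr e)) ((Equiv.sumProdDistrib ι ι κ).trans (e.sumCongr e)) (M ⊗ₖ X)) =
        Matrix.reindex e e (blkA M ⊗ₖ X) ∧
      blkB (Matrix.reindex ((Equiv.sumProdDistrib ι ι κ).trans (e.sumCongr e)) ((Equiv.sumProdDistrib ι ι κ).trans (e.sumCongr e)) (M ⊗ₖ X)) =
        Matrix.reindex e e (blkB M ⊗ₖ X) ∧
      blkC (Matrix.reindex ((Equiv.sumProdDistrib ι ι κ).trans (e.sumCongr e)) ((Equiv.sumProdDistrib ι ι κ).trans (e.sumCongr e)) (M ⊗ₖ X)) =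
        Matrix.reindex e e (blkC M ⊗ₖ X) ∧
      blkD (Matrix.reindex ((Equiv.sumProdDistrib ι ι κ).trans (e.sumCongr e)) ((Equiv.sumProdDistrib ι ι κ).trans (e.sumCongr e)) (M ⊗ₖ X)) =
        Matrix.reindex e e (blkD M ⊗ₖ X) := by
  obtain ⟨h11, h12, h21, h22⟩ := toBlocks_reindex_kronecker e M X
  have hadd := fun A B : Matrix ι ι R => (reindex_kronecker_linear e A B X (1 : R)).1
  have hsub := fun A B : Matrix ι ι R => (reindex_kronecker_linear e A B X (1 : R)).2.1
  have hsmul := fun A : Matrix ι ι R => (reindex_kronecker_linear e A A X (⅟(2 : R))).2.2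
  refine ⟨?_, ?_, ?_, ?_⟩ <;>
    simp only [blkA, blkB, blkC, blkD, h11, h12, h21, h22, hadd, hsub, hsmul]

/-- products: `reindex e (A ⊗ₖ X) · reindex e (B ⊗ₖ Y) = reindex e ((A·B) ⊗ₖ (X·Y))`. [cite: Kudla1994, §3] -/
theorem reindex_kronecker_mul [Fintype ι] [Fintype κ] [Fintype ι'] (A B : Matrix ι ι R) (X Y : Matrix κ κ R) :
    Matrix.reindex e e (A ⊗ₖ X) * Matrix.reindex e e (B ⊗ₖ Y) = Matrix.reindex e e ((A * B) ⊗ₖ (X * Y)) := by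
  rw [Matrix.reindex_apply, Matrix.reindex_apply, Matrix.reindex_apply, Matrix.submatrix_mul_equiv, Matrix.mul_kronecker_mul]

/-- inverses: `(reindex e (A ⊗ₖ 1))⁻¹ = reindex e (A⁻¹ ⊗ₖ 1)`. [cite: Kudla1994, §3] -/
theorem reindex_kronecker_one_inv [Fintype ι] [Fintype κ] [Fintype ι'] [DecidableEq ι] [DecidableEq κ] [DecidableEq ι']
    (A : Matrix ι ι R) :
    (Matrix.reindex e e (A ⊗ₖ (1 : Matrix κ κ R)))⁻¹ = Matrix.reindex e e (A⁻¹ ⊗ₖ (1 : Matrix κ κ R)) := by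
  rw [Matrix.inv_reindex, Matrix.inv_kronecker, inv_one]

/-- conjugate transpose: `((reindex e (A ⊗ₖ 1)).map σ)ᵀ = reindex e ((A.map σ)ᵀ ⊗ₖ 1)` for a ring hom `σ`. [cite: HarrisKudlaSweet1996, §1 (1.11)] -/
theorem cstar_reindex_kronecker_one [DecidableEq κ] (σ : R →+* R) (A : Matrix ι ι R) :
    ((Matrix.reindex e e (A ⊗ₖ (1 : Matrix κ κ R))).map σ)ᵀ = Matrix.reindex e e ((A.map σ)ᵀ ⊗ₖ (1 : Matrix κ κ R)) := by
  ext i j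
  simp only [Matrix.transpose_apply, Matrix.map_apply, Matrix.reindex_apply, Matrix.submatrix_apply, Matrix.kroneckerMap_apply,
    Matrix.one_apply, mul_ite, mul_one, mul_zero]
  split_ifs with h1 h2 h2
  · rfl
  · exact absurd h1.symm h2
  · exact absurd h2.symm h1
  · exact map_zero σ

/-- **Kudla's transverse matrix of a tensor pair**: `P′(M ⊗ 1, P ⊗ 1) = reindex e (P(M, P) ⊗ₖ D)` for the Gram matrix `reindex e (T ⊗ₖ D)`.
[cite: Kudla1994, §3] [cite: HarrisKudlaSweet1996, §1 (1.14)] -/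
theorem transverseMatrix_reindex_kronecker [Fintype ι] [Fintype κ] [Fintype ι'] [DecidableEq ι] [DecidableEq κ] [DecidableEq ι']
    [Invertible (2 : R)] (T : Matrix ι ι R) (D : Matrix κ κ R) (σ : R →+* R) (M P : Matrix (ι ⊕ ι) (ι ⊕ ι) R) :
    transverseMatrix (Matrix.reindex e e (T ⊗ₖ D)) σ
        (Matrix.reindex ((Equiv.sumProdDistrib ι ι κ).trans (e.sumCongr e)) ((Equiv.sumProdDistrib ι ι κ).trans (e.sumCongr e)) (M ⊗ₖ (1 : Matrix κ κ R)))
        (Matrix.reindex ((Equiv.sumProdDistrib ι ι κ).trans (e.sumCongr e)) ((Equiv.sumProdDistrib ι ι κ).trans (e.sumCongr e)) (P ⊗ₖ (1 : Matrix κ κ R))) =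
      Matrix.reindex e e (transverseMatrix T σ M P ⊗ₖ D) := by
  obtain ⟨hAM, -, hCM, -⟩ := blk_reindex_kronecker e M (1 : Matrix κ κ R)
  obtain ⟨hAP, -, hCP, -⟩ := blk_reindex_kronecker e P (1 : Matrix κ κ R)
  unfold transverseMatrix
  rw [hAM, hCM, hAP, hCP, reindex_kronecker_one_inv, reindex_kronecker_mul, reindex_kronecker_mul, Matrix.mul_one, Matrix.mul_one,
    ← (reindex_kronecker_linear e _ _ (1 : Matrix κ κ R) (1 : R)).2.1, cstar_reindex_kronecker_one, reindex_kronecker_mul, reindex_kronecker_mul,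
    Matrix.one_mul, Matrix.mul_one]

/-- determinants: `det (reindex e (H ⊗ₖ D)) = (det H)^{#κ} · (det D)^{#ι}`. [cite: HarrisKudlaSweet1996, §1 (1.16)] -/
theorem det_reindex_kronecker [Fintype ι] [Fintype κ] [Fintype ι'] [DecidableEq ι] [DecidableEq κ] [DecidableEq ι']
    (H : Matrix ι ι R) (D : Matrix κ κ R) :
    (Matrix.reindex e e (H ⊗ₖ D)).det = H.det ^ Fintype.card κ * D.det ^ Fintype.card ι := by
  rw [Matrix.det_reindex_self, Matrix.det_kronecker]

end Algebra

/-! ## §2 The K2Lit CM datum: adapted blocks and transverse matrix of `tensorEmbLoc v h = h ⊗ 1_{V′}` -/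

section CM

variable (L : Type) [Field L] [NumberField L] [IsCMField L]
variable {N M n : ℕ} (e : Fin N × Fin M ≃ Fin n)
  (dV : Fin N → L) (hdV : ∀ i, IsCMField.complexConj L (dV i) = dV i)
  (dW : Fin M → L) (hdW : ∀ i, IsCMField.complexConj L (dW i) = dW i)
variable {M₂ M' n' : ℕ} (eW : Fin M × Fin M₂ ≃ Fin M') (e' : Fin N × Fin M' ≃ Fin n')
  (dV' : Fin M₂ → L) (hdV' : ∀ k, IsCMField.complexConj L (dV' k) = dV' k)
variable (v : HeightOneSpectrum (𝓞 (Fp L)))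

/-- **the rational Gram matrix of `𝕍 ⊗ V′` is the Kronecker product**: `T₀′ = reindex epsV epsV (T₀ ⊗ₖ diag dV′)` over `L⁺`.
[cite: Kudla1994, §2 (doubled space, Siegel parabolic)] -/
theorem gramR_tensor :
    gramR L e' dV hdV (tensorFrame L dW eW dV') (tensorFrame_real L dW hdW eW dV' hdV') =
      Matrix.reindex (epsV e eW e') (epsV e eW e') (gramR L e dV hdV dW hdW ⊗ₖ realDiagonal L dV' hdV') := by
  ext a b
  obtain ⟨⟨x, k⟩, rfl⟩ := (epsV e eW e').surjective a
  obtain ⟨⟨y, l⟩, rfl⟩ := (epsV e eW e').surjective b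
  obtain ⟨⟨i, j⟩, rfl⟩ := e.surjective x
  obtain ⟨⟨i₂, j₂⟩, rfl⟩ := e.surjective y
  rw [Matrix.reindex_apply, Matrix.submatrix_apply, Equiv.symm_apply_apply, Equiv.symm_apply_apply, epsV_apply, epsV_apply,
    Matrix.kroneckerMap_apply]
  simp only [gramR, UnitaryDualPair.gram, Matrix.reindex_apply, Matrix.submatrix_apply, Equiv.symm_apply_apply,
    Matrix.kroneckerMap_apply, realDiagonal, Matrix.diagonal_apply, tensorFrame, eW.injective.eq_iff, Prod.mk.injEq,
    MulMemClass.coe_mul]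
  by_cases hi : i = i₂ <;> by_cases hj : j = j₂ <;> by_cases hk : k = l <;> (simp [hi, hj, hk]; try ring)

/-- the same read over `L⁺_v ⊗ L = Π_{w∣v} L_w`: `(T₀′)_v = reindex epsV epsV ((T₀)_v ⊗ₖ (diag dV′)_v)`. [cite: Kudla1994, §2 (doubled space, Siegel parabolic)] -/
theorem gramS_tensor :
    gramS (Fp L) L v n' (gramR L e' dV hdV (tensorFrame L dW eW dV') (tensorFrame_real L dW hdW eW dV' hdV')) =
      Matrix.reindex (epsV e eW e') (epsV e eW e') (gramS (Fp L) L v n (gramR L e dV hdV dW hdW) ⊗ₖ gramS (Fp L) L v M₂ (realDiagonal L dV' hdV')) := by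
  rw [gramR_tensor L e dV hdV dW hdW eW e' dV' hdV']
  refine Matrix.ext fun a b => ?_
  simp only [gramS, Matrix.map_apply, Matrix.reindex_apply, Matrix.submatrix_apply, Matrix.kroneckerMap_apply, map_mul]

/-- **the matrix of `h ⊗ 1` over `Π_{w∣v} L_w` is `reindex epsD epsD (matS h ⊗ₖ 1)`** (★ `coe_tensorEmbLoc_apply`, place by place).
[cite: MoeglinVignerasWaldspurger1987, Chap. 1 I.17] [cite: Kudla1994, §2 (doubled space, Siegel parabolic)] -/
theorem matS_tensorEmbLoc (h : UnitaryGroup.localPi L (IsCMField.complexConj L) (n + n) (hermD L e dV hdV dW hdW) v) :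
    matS (Fp L) L (IsCMField.complexConj L) v n' (tensorEmbLoc L e dV hdV dW hdW eW e' dV' hdV' v h) =
      Matrix.reindex (epsD e eW e') (epsD e eW e')
        (matS (Fp L) L (IsCMField.complexConj L) v n h ⊗ₖ (1 : Matrix (Fin M₂) (Fin M₂) (LocalRing L v))) := by
  refine Matrix.ext fun i j => funext fun w => ?_
  have hl := congrFun (congrFun (matS_map_eval (Fp L) L (IsCMField.complexConj L) v n'
    (tensorEmbLoc L e dV hdV dW hdW eW e' dV' hdV' v h) w) i) j
  have hr := fun a b => congrFun (congrFun (matS_map_eval (Fp L) L (IsCMField.complexConj L) v n h w) a) b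
  simp only [Matrix.map_apply, Pi.evalRingHom_apply] at hl hr
  rw [hl, coe_tensorEmbLoc_apply, Matrix.reindex_apply, Matrix.reindex_apply, Matrix.submatrix_apply, Matrix.submatrix_apply,
    Matrix.kroneckerMap_apply, Matrix.kroneckerMap_apply, Pi.mul_apply, hr, Matrix.one_apply, Matrix.one_apply]
  split_ifs <;> rfl

/-- **THE ADAPTED MATRIX OF `h ⊗ 1`**: `matA n′ (h ⊗ 1) = reindex (eΣ epsV) (eΣ epsV) (matA n h ⊗ₖ 1)`, `eΣ epsV = sumProdDistrib ≫ (epsV ⊕ epsV)` (the doubled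
enumeration `epsD` IS `e₂′ ∘ eΣ ∘ (e₂⁻¹ × 1)`, ★ `epsD_inl∕epsD_inr`). [cite: Kudla1994, §3] -/
theorem matA_tensorEmbLoc (h : UnitaryGroup.localPi L (IsCMField.complexConj L) (n + n) (hermD L e dV hdV dW hdW) v) :
    matA (Fp L) L (IsCMField.complexConj L) v n' (tensorEmbLoc L e dV hdV dW hdW eW e' dV' hdV' v h) =
      Matrix.reindex ((Equiv.sumProdDistrib (Fin n) (Fin n) (Fin M₂)).trans ((epsV e eW e').sumCongr (epsV e eW e')))
        ((Equiv.sumProdDistrib (Fin n) (Fin n) (Fin M₂)).trans ((epsV e eW e').sumCongr (epsV e eW e')))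
        (matA (Fp L) L (IsCMField.complexConj L) v n h ⊗ₖ (1 : Matrix (Fin M₂) (Fin M₂) (LocalRing L v))) := by
  rw [matA, matS_tensorEmbLoc, matA]
  ext s t
  rcases s with i | i <;> rcases t with j | j <;>
    obtain ⟨⟨x, k⟩, rfl⟩ := (epsV e eW e').surjective i <;> obtain ⟨⟨y, l⟩, rfl⟩ := (epsV e eW e').surjective j <;>
    simp only [Matrix.reindex_apply, Matrix.submatrix_apply, Equiv.symm_symm, Matrix.kroneckerMap_apply, Equiv.symm_trans_apply,
      Equiv.sumCongr_symm, Equiv.sumCongr_apply, Sum.map_inl, Sum.map_inr, Equiv.sumProdDistrib_symm_apply_left,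
      Equiv.sumProdDistrib_symm_apply_right, ← epsD_inl, ← epsD_inr, Equiv.symm_apply_apply]

/-- **the adapted blocks of `h ⊗ 1`**: `A(h ⊗ 1) = reindex epsV (A(h) ⊗ₖ 1)` and `C(h ⊗ 1) = reindex epsV (C(h) ⊗ₖ 1)`. [cite: Kudla1994, §3] -/
theorem blk_matA_tensorEmbLoc (h : UnitaryGroup.localPi L (IsCMField.complexConj L) (n + n) (hermD L e dV hdV dW hdW) v) :
    blkA (matA (Fp L) L (IsCMField.complexConj L) v n' (tensorEmbLoc L e dV hdV dW hdW eW e' dV' hdV' v h)) =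
        Matrix.reindex (epsV e eW e') (epsV e eW e')
          (blkA (matA (Fp L) L (IsCMField.complexConj L) v n h) ⊗ₖ (1 : Matrix (Fin M₂) (Fin M₂) (LocalRing L v))) ∧
      blkC (matA (Fp L) L (IsCMField.complexConj L) v n' (tensorEmbLoc L e dV hdV dW hdW eW e' dV' hdV' v h)) =
        Matrix.reindex (epsV e eW e') (epsV e eW e')
          (blkC (matA (Fp L) L (IsCMField.complexConj L) v n h) ⊗ₖ (1 : Matrix (Fin M₂) (Fin M₂) (LocalRing L v))) := by
  obtain ⟨hA, -, hC, -⟩ := blk_reindex_kronecker (epsV e eW e') (matA (Fp L) L (IsCMField.complexConj L) v n h)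
    (1 : Matrix (Fin M₂) (Fin M₂) (LocalRing L v))
  rw [matA_tensorEmbLoc]
  exact ⟨hA, hC⟩

/-- `det C(h ⊗ 1) = (det C(h))^{M₂}`. [cite: Kudla1994, §3] -/
theorem det_blkC_tensorEmbLoc (h : UnitaryGroup.localPi L (IsCMField.complexConj L) (n + n) (hermD L e dV hdV dW hdW) v) :
    (blkC (matA (Fp L) L (IsCMField.complexConj L) v n' (tensorEmbLoc L e dV hdV dW hdW eW e' dV' hdV' v h))).det =
      (blkC (matA (Fp L) L (IsCMField.complexConj L) v n h)).det ^ M₂ := by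
  rw [(blk_matA_tensorEmbLoc L e dV hdV dW hdW eW e' dV' hdV' v h).2, det_reindex_kronecker, Matrix.det_one, one_pow, mul_one,
    Fintype.card_fin]

/-- **big cell ↦ big cell, and only so** (for `M₂ ≠ 0`): `C(h ⊗ 1)` is invertible iff `C(h)` is. [cite: Kudla1994, §3] -/
theorem isUnit_blkC_tensorEmbLoc_iff (hM₂ : M₂ ≠ 0) (h : UnitaryGroup.localPi L (IsCMField.complexConj L) (n + n) (hermD L e dV hdV dW hdW) v) :
    IsUnit (blkC (matA (Fp L) L (IsCMField.complexConj L) v n' (tensorEmbLoc L e dV hdV dW hdW eW e' dV' hdV' v h))) ↔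
      IsUnit (blkC (matA (Fp L) L (IsCMField.complexConj L) v n h)) := by
  rw [Matrix.isUnit_iff_isUnit_det, Matrix.isUnit_iff_isUnit_det, det_blkC_tensorEmbLoc, isUnit_pow_iff hM₂]

/-- `C(h)` invertible ⇒ `C(h ⊗ 1)` invertible (any `M₂`). [cite: Kudla1994, §3] -/
theorem isUnit_blkC_tensorEmbLoc {h : UnitaryGroup.localPi L (IsCMField.complexConj L) (n + n) (hermD L e dV hdV dW hdW) v}
    (hh : IsUnit (blkC (matA (Fp L) L (IsCMField.complexConj L) v n h))) :
    IsUnit (blkC (matA (Fp L) L (IsCMField.complexConj L) v n' (tensorEmbLoc L e dV hdV dW hdW eW e' dV' hdV' v h))) := by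
  rw [Matrix.isUnit_iff_isUnit_det, det_blkC_tensorEmbLoc]
  exact ((Matrix.isUnit_iff_isUnit_det _).1 hh).pow M₂

/-- **`P_Δ ↦ P_{Δ′}`** (local twin of ★ `isSiegelDelta_tensorEmb`): `h ∈ P_Δ(L⁺_v) ⇒ h ⊗ 1 ∈ P_{Δ′}(L⁺_v)` (`C = 0 ⇒ C ⊗ 1 = 0`).
[cite: Kudla1994, §3] [cite: HarrisKudlaSweet1996, §1 (1.11)] -/
theorem isSiegelDelta_tensorEmbLoc {h : UnitaryGroup.localPi L (IsCMField.complexConj L) (n + n) (hermD L e dV hdV dW hdW) v}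
    (hh : IsSiegelDelta (Fp L) L (IsCMField.complexConj L) (complexConj_imagUnit L) (imagUnit_ne_zero L) (imagUnit_mul_self L) v n
      (gramR_isSymm L e dV hdV dW hdW) (hermD_eq_map_gramD L e dV hdV dW hdW) h) :
    IsSiegelDelta (Fp L) L (IsCMField.complexConj L) (complexConj_imagUnit L) (imagUnit_ne_zero L) (imagUnit_mul_self L) v n'
      (gramR_isSymm L e' dV hdV (tensorFrame L dW eW dV') (tensorFrame_real L dW hdW eW dV' hdV'))
      (hermD_eq_map_gramD L e' dV hdV (tensorFrame L dW eW dV') (tensorFrame_real L dW hdW eW dV' hdV'))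
      (tensorEmbLoc L e dV hdV dW hdW eW e' dV' hdV' v h) := by
  haveI : Algebra.IsQuadraticExtension (Fp L) L := IsCMField.isQuadraticExtension L
  have hC := (isSiegelDelta_iff_blkC_eq_zero (Fp L) L (IsCMField.complexConj L) (complexConj_imagUnit L) (imagUnit_ne_zero L)
    (imagUnit_mul_self L) v n (gramR_isSymm L e dV hdV dW hdW) (hermD_eq_map_gramD L e dV hdV dW hdW) h).1 hh
  refine (isSiegelDelta_iff_blkC_eq_zero (Fp L) L (IsCMField.complexConj L) (complexConj_imagUnit L) (imagUnit_ne_zero L)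
    (imagUnit_mul_self L) v n' (gramR_isSymm L e' dV hdV (tensorFrame L dW eW dV') (tensorFrame_real L dW hdW eW dV' hdV'))
    (hermD_eq_map_gramD L e' dV hdV (tensorFrame L dW eW dV') (tensorFrame_real L dW hdW eW dV' hdV')) _).2 ?_
  rw [(blk_matA_tensorEmbLoc L e dV hdV dW hdW eW e' dV' hdV' v h).2, hC]
  ext i j
  simp [Matrix.reindex_apply]

set_option maxHeartbeats 400000 in -- the `rw`s retype Kudla's transverse matrix over the `tensorEmbLoc` telescope (slow `whnf`, no search)
/-- **THE TRANSVERSE HERMITIAN MATRIX OF A TENSOR PAIR**: `H′(a ⊗ 1, b ⊗ 1) = reindex epsV epsV (H(a, b) ⊗ₖ (diag dV′)_v)`.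
[cite: Kudla1994, §3] [cite: HarrisKudlaSweet1996, §1 (1.14)] -/
theorem transverseHerm_tensorEmbLoc (a b : UnitaryGroup.localPi L (IsCMField.complexConj L) (n + n) (hermD L e dV hdV dW hdW) v) :
    transverseHerm (Fp L) L (IsCMField.complexConj L) v n' (imagUnit L) (imagUnitSq L)
        (gramR L e' dV hdV (tensorFrame L dW eW dV') (tensorFrame_real L dW hdW eW dV' hdV'))
        (tensorEmbLoc L e dV hdV dW hdW eW e' dV' hdV' v a) (tensorEmbLoc L e dV hdV dW hdW eW e' dV' hdV' v b) =
      Matrix.reindex (epsV e eW e') (epsV e eW e')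
        (transverseHerm (Fp L) L (IsCMField.complexConj L) v n (imagUnit L) (imagUnitSq L) (gramR L e dV hdV dW hdW) a b ⊗ₖ
          gramS (Fp L) L v M₂ (realDiagonal L dV' hdV')) := by
  rw [transverseHerm, transverseHerm, ← (tensorEmbLoc L e dV hdV dW hdW eW e' dV' hdV' v).map_mul a b,
    matA_tensorEmbLoc L e dV hdV dW hdW eW e' dV' hdV' v a, matA_tensorEmbLoc L e dV hdV dW hdW eW e' dV' hdV' v (a * b),
    gramS_tensor L e dV hdV dW hdW eW e' dV' hdV' v, transverseMatrix_reindex_kronecker,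
    ← (reindex_kronecker_linear (epsV e eW e') _ 0 (gramS (Fp L) L v M₂ (realDiagonal L dV' hdV')) _).2.2]

set_option maxHeartbeats 400000 in -- idem
/-- **its determinant**: `det H′(a ⊗ 1, b ⊗ 1) = (det H(a, b))^{M₂} · ((∏_k dV′_k)_v)^n`. [cite: HarrisKudlaSweet1996, §1 (1.16)] -/
theorem det_transverseHerm_tensorEmbLoc (a b : UnitaryGroup.localPi L (IsCMField.complexConj L) (n + n) (hermD L e dV hdV dW hdW) v) :
    (transverseHerm (Fp L) L (IsCMField.complexConj L) v n' (imagUnit L) (imagUnitSq L)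
        (gramR L e' dV hdV (tensorFrame L dW eW dV') (tensorFrame_real L dW hdW eW dV' hdV'))
        (tensorEmbLoc L e dV hdV dW hdW eW e' dV' hdV' v a) (tensorEmbLoc L e dV hdV dW hdW eW e' dV' hdV' v b)).det =
      (transverseHerm (Fp L) L (IsCMField.complexConj L) v n (imagUnit L) (imagUnitSq L) (gramR L e dV hdV dW hdW) a b).det ^ M₂ *
        toLocalRing L v (algebraMap (Fp L) (v.adicCompletion (Fp L)) (realDiagonal L dV' hdV').det) ^ n := by
  rw [transverseHerm_tensorEmbLoc L e dV hdV dW hdW eW e' dV' hdV' v a b, det_reindex_kronecker, Fintype.card_fin, Fintype.card_fin, gramS,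
    ← RingHom.mapMatrix_apply, ← RingHom.mapMatrix_apply, ← RingHom.map_det, ← RingHom.map_det]

end CM

end Summit.HodgeConjecture.HodgeConjecture.Cruxes.HLiu418.K2LiuLocalSWTensorAdaptedBlocks

end
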